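import Mathlib.Analysis.Normed.Group.InfiniteSum
import Mathlib.Analysis.SpecificLimits.Normed
import Literature.Barriers.CriticalPhenomena.WeaklySAWCouplingFlowCutoffDecay
import HarnessLib

/-!
# [BBS-rg-flow, Lemma 2.2 and Proposition 1.2] in the printed generality: the unique global flow
# `V̄ = (ḡ, z̄, μ̄)` of the quadratic flow `φ̄` with `ḡ₀ = g₀`, `(z̄_∞, μ̄_∞) = (0,0)`

Fourth file of the series formalising [BBS-rg-flow] (Bauerschmidt–Brydges–Slade, AHP 16 (2015),
arXiv:1211.2477), the abstract dynamical-system input of BBS 2015, Theorem 4.1 (via its Theorem 7.2.1),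
towards `Literature.Barriers.CriticalPhenomena.WeaklySAWFourDimLogCorrections`. It continues
`WeaklySAWCouplingFlowCutoff*.lean` (Lemma 2.1) and generalises `WeaklySAWQuadraticFlow.lean` (the
massless case `χ ≡ 1`, `ζ = γ = υ^{zz} = υ^{zμ} = 0`) to the printed generality of §2.2 of the source:
all eleven parameter sequences of `φ̄` ((1.1)–(1.3)), the weights `χ_j = Ω^{-(j-k)₊}` of an arbitrary
cut-off `k ∈ ℕ ∪ {∞}`, and finitely many exceptional scales on which `β_j < c` or `ζ_j > 0`.

Main results (explicit constants in place of the printed `O(·)`; `C_{2,0} = (1+N)/c + N + 2Ω/(Ω-1)`,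
`Z = 2C·C_{2,0}`, `K_σ = C(3+3Z+Z²)/2`, `α = 2/(1+λ)`):
* two more instances of Lemma 2.1(ii)(a), (2.3), as tails: `(n,m) = (3,0)` and `(3,1)`
  (`tsum_weight_mul_gbar_cube_le`, `tsum_weight_mul_gbar_cube_log_le`: `Σ_{l≥j}χ_lḡ_l³(|log ḡ_l|) ≤
  2C_{2,0}χ_jḡ_j²(|log ḡ_j|)`), reduced to `(2,0)` through `ḡ_l ≤ 2ḡ_j` and the monotonicity of
  `t|log t|` on `(0, e⁻¹]` (`mul_abs_log_le_mul_abs_log`, extra smallness `4g₀ ≤ e⁻¹`);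
* `QuadFlowParams.zbar`, `.tau`, `.sigma`, `.mubar`, `.flow` — the printed solution formulas (2.14),
  (2.16), (2.19): `z̄_j = Σ_{l≥j} ∏_{k=j}^l(1-ζ_kḡ_k)⁻¹θ_lḡ_l²`,
  `μ̄_j = -Σ_{l≥j} ∏_{k=j}^l(λ_k-τ_k)⁻¹σ_l`, and `V̄_j = (ḡ_j, z̄_j, μ̄_j)`;
* `CutoffQuadHyp P Ω k B c N C lam g₀` — the hypotheses (Lemma 2.1's `CutoffGbarHyp` + Assumption
  (A2) with explicit constants + explicit smallness of `g₀`), and `cutoffQuadHyp_of_hypA`: Assumptions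
  (A1)–(A2) of `WeaklySAWFlowStructuralStability.lean` imply them at `k = j_Ω`, `N = ⌊c⁻¹⌋`, for all
  `0 < g₀ ≤ quadThreshold Ω B c C lam` (an explicit positive threshold);
* Lemma 2.2 [`zbar_succ`, `abs_zbar_le`, `tendsto_zbar_zero`, `zbar_unique`, `mubar_succ`,
  `abs_mubar_le`, `tendsto_mubar_zero`, `mubar_unique`]: the recursions
  `z̄_{j+1} = z̄_j - θ_jḡ_j² - ζ_jḡ_jz̄_j`, `μ̄_{j+1} = (λ_j - τ_j)μ̄_j + σ_j`, the bounds (2.15)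
  `|z̄_j| ≤ Zχ_jḡ_j` and (2.21) `|μ̄_j| ≤ (4K_σ/(λ-1))χ_jḡ_j`, the final conditions, and uniqueness
  (for `z̄`: homogeneous solutions do not decay, by Lemma 2.1(iii)(b); for `μ̄`: the direction is
  expanding, `λ_j - τ_j ≥ (1+λ)/2 > 1` by (2.18));
* Proposition 1.2 [`isQuadFlowBC_flow`, `eq_flow_of_isQuadFlowBC`, `quadFlow_exists_unique`]:
  for `g₀ ∈ (0, g₁)` the sequence `V̄` is a global flow of `φ̄` with `ḡ₀ = g₀`, `(z̄_∞, μ̄_∞) = (0,0)`,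
  it is the UNIQUE such flow, and (1.9) holds: `0 < ḡ_j ≤ 2ḡ₀`, `χ_jḡ_jⁿ ≤ C_n(ḡ₀/(1+ḡ₀j))ⁿ` (real
  `n ≥ 1`), `|z̄_j|, |μ̄_j| ≤ C'χ_jḡ_j`, with `g₁, C', C_n` depending only on `(Ω, B, c, λ, C)` — in the
  quantifier shape "∃ thresholds/constants, ∀ systems satisfying (A1)–(A2)" demanded by the printed
  "constants independent of `j_Ω` and `ḡ₀`".

Deliberately NOT here: the regularity clauses of Proposition 1.2 (`V̄_j` is `C¹` in `g₀` — Lemma 2.3 —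
and continuous in an external parameter — last part of Lemma 2.2), which are the next step, and the
lower bound `½λ⁻¹ ≤ (λ_j - τ_j)⁻¹` of (2.18) (it needs an upper bound on `λ_j` that (A2) does not print
and is not used).

## References
* R. Bauerschmidt, D. C. Brydges, G. Slade, *Structural stability of a dynamical system near a
  non-hyperbolic fixed point*, Ann. Henri Poincaré 16 (2015), arXiv:1211.2477: Proposition 1.2, (1.9),
  Lemma 2.2, (2.14)–(2.21), §2.4. [BauerschmidtBrydgesSlade2015Flow]
* R. Bauerschmidt, D. C. Brydges, G. Slade, CMP 337 (2015), Proposition 6.1.1 and §6.1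
  (Assumptions (A1)–(A2)). [BauerschmidtBrydgesSlade2015LogCorr]
-/

noncomputable section

open Filter Topology Set
open scoped BigOperators

namespace Literature.Barriers.CriticalPhenomena

namespace CTWSAW

/-! ### Two more sums of Lemma 2.1(ii)(a): `(n,m) = (3,1), (3,0)` as tails, and `t|log t|` -/

/-- `t ↦ t|log t|` is non-decreasing on `(0, e⁻¹]`: for `0 < s ≤ t ≤ e⁻¹`, `s|log s| ≤ t|log t|`.
[folklore] -/
theorem mul_abs_log_le_mul_abs_log {s t : ℝ} (hs : 0 < s) (hst : s ≤ t) (ht : t ≤ Real.exp (-1)) :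
    s * |Real.log s| ≤ t * |Real.log t| := by
  have ht0 : 0 < t := lt_of_lt_of_le hs hst
  have hlt : ∀ {u : ℝ}, 0 < u → u ≤ Real.exp (-1) → Real.log u ≤ -1 := fun {u} hu hu1 => by
    have := Real.log_le_log hu hu1; rwa [Real.log_exp] at this
  have hls : Real.log s ≤ -1 := hlt hs (hst.trans ht)
  have hlt' : Real.log t ≤ -1 := hlt ht0 ht
  rw [abs_of_neg (by linarith), abs_of_neg (by linarith)]
  -- `-s log s ≤ -t log t`: the function `-u log u` has derivative `-(log u + 1) ≥ 0` on `(0, e⁻¹]`;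
  -- elementary proof via `log t - log s ≤ (t - s)/s` is awkward; use `log(t/s) ≥ 1 - s/t`.
  have hkey : s * Real.log (t / s) ≤ t - s := by
    have := Real.log_le_sub_one_of_pos (div_pos ht0 hs)
    have h2 : s * (t / s - 1) = t - s := by field_simp
    calc s * Real.log (t / s) ≤ s * (t / s - 1) := mul_le_mul_of_nonneg_left this hs.le
      _ = t - s := h2
  rw [Real.log_div ht0.ne' hs.ne'] at hkey
  -- `-s log s + t log t = s(log t - log s) + (t - s) log t ≤ (t - s) + (t-s) log t = (t-s)(1 + log t) ≤ 0`
  nlinarith [mul_nonneg (sub_nonneg.2 hst) (by linarith : (0:ℝ) ≤ -(1 + Real.log t))]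

namespace CutoffGbarHyp

variable {β : ℕ → ℝ} {Ω : ℝ} {k : ℕ∞} {B c : ℝ} {N : ℕ} {g₀ : ℝ} (h : CutoffGbarHyp β Ω k B c N g₀)
include h

/-- `ḡ_l|log ḡ_l| ≤ 2ḡ_j|log ḡ_j|` for `l ≥ j`, provided `g₀ ≤ e⁻¹/4` (then `2ḡ_j ≤ 4g₀ ≤ e⁻¹`).
[cite: BauerschmidtBrydgesSlade2015Flow, Lemma 2.1(ii)(a) (the case n > 1 of (2.3))] -/
theorem gbar_mul_abs_log_le {j l : ℕ} (hjl : j ≤ l) (hsmall : 4 * g₀ ≤ Real.exp (-1)) :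
    gbar β g₀ l * |Real.log (gbar β g₀ l)| ≤ 2 * (gbar β g₀ j * |Real.log (gbar β g₀ j)|) := by
  have h1 := h.gbar_le_two_mul hjl
  have hgl := h.gbar_pos l; have hgj := h.gbar_pos j
  have h2gj : 2 * gbar β g₀ j ≤ Real.exp (-1) := by linarith [h.gbar_le_two_mul_init j]
  have h2 := mul_abs_log_le_mul_abs_log hgl h1 h2gj
  -- `2ḡ_j |log(2ḡ_j)| ≤ 2ḡ_j |log ḡ_j|` since `ḡ_j ≤ 2ḡ_j ≤ 1`
  have h3 : |Real.log (2 * gbar β g₀ j)| ≤ |Real.log (gbar β g₀ j)| := by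
    have hle1 : 2 * gbar β g₀ j ≤ 1 := by linarith [h.gbar_le_half j]
    rw [abs_of_nonpos (Real.log_nonpos (by linarith) hle1),
      abs_of_nonpos (Real.log_nonpos hgj.le (by linarith))]
    have := Real.log_le_log hgj (by linarith : gbar β g₀ j ≤ 2 * gbar β g₀ j)
    linarith
  calc gbar β g₀ l * |Real.log (gbar β g₀ l)| ≤ 2 * gbar β g₀ j * |Real.log (2 * gbar β g₀ j)| := h2
    _ ≤ 2 * gbar β g₀ j * |Real.log (gbar β g₀ j)| := by gcongr
    _ = _ := by ring

/-- **(2.3) with `(n,m) = (3,0)` as a tail**: `Σ_{l≥j} Ω^{-(l-k)₊}ḡ_l³ ≤ 2C_{2,0} Ω^{-(j-k)₊}ḡ_j²`.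
[cite: BauerschmidtBrydgesSlade2015Flow, Lemma 2.1(ii)(a), (2.3)] -/
theorem tsum_weight_mul_gbar_cube_le (j : ℕ) :
    Summable (fun l => cutoffWeight Ω k (l + j) * gbar β g₀ (l + j) ^ 3) ∧
      ∑' l, cutoffWeight Ω k (l + j) * gbar β g₀ (l + j) ^ 3 ≤
        2 * ((1 + N) / c + N + 2 * Ω / (Ω - 1)) * (cutoffWeight Ω k j * gbar β g₀ j ^ 2) := by
  obtain ⟨hs, ht⟩ := h.summable_weight_mul_gbar_sq j
  have hle : ∀ l, cutoffWeight Ω k (l + j) * gbar β g₀ (l + j) ^ 3 ≤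
      2 * gbar β g₀ j * (cutoffWeight Ω k (l + j) * gbar β g₀ (l + j) ^ 2) := fun l => by
    have h1 := h.gbar_le_two_mul (Nat.le_add_left j l)
    have := (h.weight_pos (l + j)).le; have := (h.gbar_pos (l + j)).le
    calc cutoffWeight Ω k (l + j) * gbar β g₀ (l + j) ^ 3
        = gbar β g₀ (l + j) * (cutoffWeight Ω k (l + j) * gbar β g₀ (l + j) ^ 2) := by ring
      _ ≤ _ := mul_le_mul_of_nonneg_right h1 (by positivity)
  have hnn : ∀ l, 0 ≤ cutoffWeight Ω k (l + j) * gbar β g₀ (l + j) ^ 3 := fun l =>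
    mul_nonneg (h.weight_pos _).le (pow_nonneg (h.gbar_pos _).le 3)
  have hsum : Summable fun l => cutoffWeight Ω k (l + j) * gbar β g₀ (l + j) ^ 3 :=
    Summable.of_nonneg_of_le hnn hle (hs.mul_left _)
  refine ⟨hsum, ?_⟩
  calc ∑' l, cutoffWeight Ω k (l + j) * gbar β g₀ (l + j) ^ 3
      ≤ ∑' l, 2 * gbar β g₀ j * (cutoffWeight Ω k (l + j) * gbar β g₀ (l + j) ^ 2) :=
        Summable.tsum_le_tsum hle hsum (hs.mul_left _)
    _ = 2 * gbar β g₀ j * ∑' l, cutoffWeight Ω k (l + j) * gbar β g₀ (l + j) ^ 2 := tsum_mul_left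
    _ ≤ 2 * gbar β g₀ j * (((1 + N) / c + N + 2 * Ω / (Ω - 1)) * (cutoffWeight Ω k j * gbar β g₀ j)) :=
        mul_le_mul_of_nonneg_left ht (by linarith [h.gbar_pos j])
    _ = _ := by ring

/-- **(2.3) with `(n,m) = (3,1)` as a tail**: `Σ_{l≥j} Ω^{-(l-k)₊}ḡ_l³|log ḡ_l| ≤
2C_{2,0} Ω^{-(j-k)₊}ḡ_j²|log ḡ_j|` (extra smallness `4g₀ ≤ e⁻¹`).
[cite: BauerschmidtBrydgesSlade2015Flow, Lemma 2.1(ii)(a), (2.3)] -/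
theorem tsum_weight_mul_gbar_cube_log_le (hsmall : 4 * g₀ ≤ Real.exp (-1)) (j : ℕ) :
    Summable (fun l => cutoffWeight Ω k (l + j) * gbar β g₀ (l + j) ^ 3 * |Real.log (gbar β g₀ (l + j))|) ∧
      ∑' l, cutoffWeight Ω k (l + j) * gbar β g₀ (l + j) ^ 3 * |Real.log (gbar β g₀ (l + j))| ≤
        2 * ((1 + N) / c + N + 2 * Ω / (Ω - 1)) *
          (cutoffWeight Ω k j * gbar β g₀ j ^ 2 * |Real.log (gbar β g₀ j)|) := by
  obtain ⟨hs, ht⟩ := h.summable_weight_mul_gbar_sq j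
  set Lj := gbar β g₀ j * |Real.log (gbar β g₀ j)| with hLj
  have hle : ∀ l, cutoffWeight Ω k (l + j) * gbar β g₀ (l + j) ^ 3 * |Real.log (gbar β g₀ (l + j))| ≤
      2 * Lj * (cutoffWeight Ω k (l + j) * gbar β g₀ (l + j) ^ 2) := fun l => by
    have h1 := h.gbar_mul_abs_log_le (Nat.le_add_left j l) hsmall
    have := (h.weight_pos (l + j)).le; have := (h.gbar_pos (l + j)).le
    calc cutoffWeight Ω k (l + j) * gbar β g₀ (l + j) ^ 3 * |Real.log (gbar β g₀ (l + j))|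
        = (gbar β g₀ (l + j) * |Real.log (gbar β g₀ (l + j))|) *
            (cutoffWeight Ω k (l + j) * gbar β g₀ (l + j) ^ 2) := by ring
      _ ≤ _ := mul_le_mul_of_nonneg_right h1 (by positivity)
  have hnn : ∀ l, 0 ≤ cutoffWeight Ω k (l + j) * gbar β g₀ (l + j) ^ 3 * |Real.log (gbar β g₀ (l + j))| :=
    fun l => mul_nonneg (mul_nonneg (h.weight_pos _).le (pow_nonneg (h.gbar_pos _).le 3)) (abs_nonneg _)
  have hsum := Summable.of_nonneg_of_le hnn hle (hs.mul_left _)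
  refine ⟨hsum, ?_⟩
  have hLj0 : 0 ≤ Lj := mul_nonneg (h.gbar_pos j).le (abs_nonneg _)
  calc ∑' l, cutoffWeight Ω k (l + j) * gbar β g₀ (l + j) ^ 3 * |Real.log (gbar β g₀ (l + j))|
      ≤ ∑' l, 2 * Lj * (cutoffWeight Ω k (l + j) * gbar β g₀ (l + j) ^ 2) :=
        Summable.tsum_le_tsum hle hsum (hs.mul_left _)
    _ = 2 * Lj * ∑' l, cutoffWeight Ω k (l + j) * gbar β g₀ (l + j) ^ 2 := tsum_mul_left
    _ ≤ 2 * Lj * (((1 + N) / c + N + 2 * Ω / (Ω - 1)) * (cutoffWeight Ω k j * gbar β g₀ j)) :=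
        mul_le_mul_of_nonneg_left ht (by positivity)
    _ = _ := by rw [hLj]; ring

end CutoffGbarHyp


/-! ## [BBS-rg-flow, Lemma 2.2]: the flow of `z̄` and `μ̄` in the printed generality -/

namespace QuadFlowParams

variable (P : QuadFlowParams) (g₀ : ℝ)

/-- `Π^ζ_{j,l} = ∏_{k=j}^{j+l} (1 - ζ_kḡ_k)⁻¹`, the propagator of the `z̄`-equation.
[cite: BauerschmidtBrydgesSlade2015Flow, Lemma 2.2 (proof, first display) and Lemma 2.3 (σ_{j,l})] -/
def zetaInvProd (j l : ℕ) : ℝ :=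
  ∏ i ∈ Finset.range (l + 1), (1 - P.ζ (i + j) * gbar P.β g₀ (i + j))⁻¹

/-- `z̄_j = Σ_{l ≥ j} ∏_{k=j}^l (1 - ζ_kḡ_k)⁻¹ θ_lḡ_l²`, the solution (2.14) of the `z̄`-equation
`z̄_{j+1} = z̄_j - ζ_jḡ_jz̄_j - θ_jḡ_j²` with `z̄_∞ = 0`. [cite: BauerschmidtBrydgesSlade2015Flow, Lemma 2.2, (2.14)] -/
def zbar (j : ℕ) : ℝ :=
  ∑' l, P.zetaInvProd g₀ j l * (P.θ (l + j) * gbar P.β g₀ (l + j) ^ 2)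

/-- `τ_j = υ_j^{gμ}ḡ_j + υ_j^{zμ}z̄_j` ((2.16)). [cite: BauerschmidtBrydgesSlade2015Flow, Lemma 2.2, (2.16)] -/
def tau (j : ℕ) : ℝ := P.υgμ j * gbar P.β g₀ j + P.υzμ j * P.zbar g₀ j

/-- `σ_j = η_jḡ_j + γ_jz̄_j - υ_j^{gg}ḡ_j² - υ_j^{gz}ḡ_jz̄_j - υ_j^{zz}z̄_j²` ((2.16)).
[cite: BauerschmidtBrydgesSlade2015Flow, Lemma 2.2, (2.16)] -/
def sigma (j : ℕ) : ℝ :=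
  P.η j * gbar P.β g₀ j + P.γ j * P.zbar g₀ j - P.υgg j * gbar P.β g₀ j ^ 2 -
    P.υgz j * gbar P.β g₀ j * P.zbar g₀ j - P.υzz j * P.zbar g₀ j ^ 2

/-- `∏_{k=j}^{j+l} (λ_k - τ_k)⁻¹`, the propagator of the `μ̄`-equation read backwards ((2.17)).
[cite: BauerschmidtBrydgesSlade2015Flow, Lemma 2.2, (2.17)–(2.19)] -/
def lamInvProd (j l : ℕ) : ℝ := ∏ i ∈ Finset.range (l + 1), (P.lam (i + j) - P.tau g₀ (i + j))⁻¹

/-- `μ̄_j = -Σ_{l ≥ j} (∏_{k=j}^l (λ_k - τ_k)⁻¹) σ_l`, the solution (2.19) of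
`μ̄_{j+1} = (λ_j - τ_j)μ̄_j + σ_j` with `μ̄_∞ = 0`. [cite: BauerschmidtBrydgesSlade2015Flow, Lemma 2.2, (2.19)] -/
def mubar (j : ℕ) : ℝ := -∑' l, P.lamInvProd g₀ j l * P.sigma g₀ (l + j)

/-- The candidate global flow `V̄_j = (ḡ_j, z̄_j, μ̄_j)` of `φ̄`. [cite: BauerschmidtBrydgesSlade2015Flow, Proposition 1.2 and §2] -/
def flow (j : ℕ) : V3 := ![gbar P.β g₀ j, P.zbar g₀ j, P.mubar g₀ j]

/-- `V̄_j 0 = ḡ_j`. [cite: BauerschmidtBrydgesSlade2015Flow, Proposition 1.2] -/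
@[simp] theorem flow_apply_zero (j : ℕ) : P.flow g₀ j 0 = gbar P.β g₀ j := rfl

/-- `V̄_j 1 = z̄_j`. [cite: BauerschmidtBrydgesSlade2015Flow, Proposition 1.2] -/
@[simp] theorem flow_apply_one (j : ℕ) : P.flow g₀ j 1 = P.zbar g₀ j := rfl

/-- `V̄_j 2 = μ̄_j`. [cite: BauerschmidtBrydgesSlade2015Flow, Proposition 1.2] -/
@[simp] theorem flow_apply_two (j : ℕ) : P.flow g₀ j 2 = P.mubar g₀ j := rfl

/-- `Π^ζ_{j,0} = (1 - ζ_jḡ_j)⁻¹`. [cite: BauerschmidtBrydgesSlade2015Flow, Lemma 2.2 (proof)] -/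
theorem zetaInvProd_zero (j : ℕ) : P.zetaInvProd g₀ j 0 = (1 - P.ζ j * gbar P.β g₀ j)⁻¹ := by
  simp [zetaInvProd]

/-- `Π^ζ_{j,l+1} = (1 - ζ_jḡ_j)⁻¹ Π^ζ_{j+1,l}`. [cite: BauerschmidtBrydgesSlade2015Flow, Lemma 2.2 (proof)] -/
theorem zetaInvProd_succ (j l : ℕ) :
    P.zetaInvProd g₀ j (l + 1) = (1 - P.ζ j * gbar P.β g₀ j)⁻¹ * P.zetaInvProd g₀ (j + 1) l := by
  unfold zetaInvProd
  rw [Finset.prod_range_succ' _ (l + 1), zero_add, mul_comm]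
  congr 1
  exact Finset.prod_congr rfl fun i _ => by rw [Nat.add_right_comm, Nat.add_assoc]

/-- `Π^ζ_{j,l}` as a product over the interval of scales `[j, j+l]`. [cite: BauerschmidtBrydgesSlade2015Flow, Lemma 2.2 (proof)] -/
theorem zetaInvProd_eq_prod_Icc (j l : ℕ) :
    P.zetaInvProd g₀ j l = ∏ m ∈ Finset.Icc j (j + l), (1 - P.ζ m * gbar P.β g₀ m)⁻¹ := by
  unfold zetaInvProd
  rw [Finset.range_eq_Ico, Finset.prod_Ico_add' (fun m => (1 - P.ζ m * gbar P.β g₀ m)⁻¹), zero_add,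
    show l + 1 + j = j + l + 1 by ring, Finset.Ico_add_one_right_eq_Icc]

/-- `∏_{k=j}^{j} (λ_k - τ_k)⁻¹ = (λ_j - τ_j)⁻¹`. [cite: BauerschmidtBrydgesSlade2015Flow, Lemma 2.2, (2.17)] -/
theorem lamInvProd_zero (j : ℕ) : P.lamInvProd g₀ j 0 = (P.lam j - P.tau g₀ j)⁻¹ := by
  simp [lamInvProd]

/-- `∏_{k=j}^{j+l+1} (λ_k - τ_k)⁻¹ = (λ_j - τ_j)⁻¹ ∏_{k=j+1}^{j+1+l} (λ_k - τ_k)⁻¹`.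
[cite: BauerschmidtBrydgesSlade2015Flow, Lemma 2.2, (2.17)–(2.19)] -/
theorem lamInvProd_succ (j l : ℕ) :
    P.lamInvProd g₀ j (l + 1) = (P.lam j - P.tau g₀ j)⁻¹ * P.lamInvProd g₀ (j + 1) l := by
  unfold lamInvProd
  rw [Finset.prod_range_succ' _ (l + 1), zero_add, mul_comm]
  congr 1
  exact Finset.prod_congr rfl fun i _ => by rw [Nat.add_right_comm, Nat.add_assoc]

end QuadFlowParams

/-! ### Hypotheses of Lemma 2.2 for an arbitrary cut-off, with explicit constants and smallness -/

/-- The hypotheses of [BBS-rg-flow, Lemma 2.2] for an arbitrary cut-off `k ∈ ℕ ∪ {∞}`: those of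
Lemma 2.1 on `β` (`CutoffGbarHyp`) together with Assumption (A2) with explicit constants
(`λ_j ≥ λ > 1`; `ζ_j ≤ 0` for all `j ≤ k` off at most `N` exceptional scales; `|η_j|, |γ_j|, |θ_j|,
|ζ_j|, |υ_j^{αβ}| ≤ CΩ^{-(j-k)₊}`) and the smallness of `g₀` used in the proof (`4Cg₀ ≤ 1`,
`8Cg₀(N + 1/(Ω-1)) ≤ 1` for Lemma 2.1(iii)(b); `2Cg₀(1 + 2C·C_{2,0}) ≤ (λ-1)/2` for
`(λ_j - τ_j)⁻¹ ≤ α < 1`, where `C_{2,0} = (1+N)/c + N + 2Ω/(Ω-1)` is the constant of (2.3)).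
[cite: BauerschmidtBrydgesSlade2015Flow, Assumptions (A1)–(A2), Lemma 2.2 and (2.18)] -/
structure CutoffQuadHyp (P : QuadFlowParams) (Ω : ℝ) (k : ℕ∞) (B c : ℝ) (N : ℕ) (C lam g₀ : ℝ) :
    Prop extends CutoffGbarHyp P.β Ω k B c N g₀ where
  /-- `λ > 1`. -/
  one_lt_lam : 1 < lam
  /-- `λ_j ≥ λ`. -/
  lam_le : ∀ j, lam ≤ P.lam j
  /-- `C ≥ 0`. -/
  C_nonneg : 0 ≤ C
  /-- `ζ_j ≤ 0` for `j ≤ k` off at most `N` exceptional scales. -/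
  zeta_exc : ∃ s : Finset ℕ, s.card ≤ N ∧ ∀ j : ℕ, (j : ℕ∞) ≤ k → j ∉ s → P.ζ j ≤ 0
  /-- `|η_j| ≤ CΩ^{-(j-k)₊}`. -/
  eta_le : ∀ j, |P.η j| ≤ C * cutoffWeight Ω k j
  /-- `|γ_j| ≤ CΩ^{-(j-k)₊}`. -/
  gamma_le : ∀ j, |P.γ j| ≤ C * cutoffWeight Ω k j
  /-- `|θ_j| ≤ CΩ^{-(j-k)₊}`. -/
  theta_le : ∀ j, |P.θ j| ≤ C * cutoffWeight Ω k j
  /-- `|ζ_j| ≤ CΩ^{-(j-k)₊}`. -/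
  zeta_le : ∀ j, |P.ζ j| ≤ C * cutoffWeight Ω k j
  /-- `|υ_j^{gg}| ≤ CΩ^{-(j-k)₊}`. -/
  υgg_le : ∀ j, |P.υgg j| ≤ C * cutoffWeight Ω k j
  /-- `|υ_j^{gz}| ≤ CΩ^{-(j-k)₊}`. -/
  υgz_le : ∀ j, |P.υgz j| ≤ C * cutoffWeight Ω k j
  /-- `|υ_j^{gμ}| ≤ CΩ^{-(j-k)₊}`. -/
  υgμ_le : ∀ j, |P.υgμ j| ≤ C * cutoffWeight Ω k j
  /-- `|υ_j^{zz}| ≤ CΩ^{-(j-k)₊}`. -/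
  υzz_le : ∀ j, |P.υzz j| ≤ C * cutoffWeight Ω k j
  /-- `|υ_j^{zμ}| ≤ CΩ^{-(j-k)₊}`. -/
  υzμ_le : ∀ j, |P.υzμ j| ≤ C * cutoffWeight Ω k j
  /-- smallness for Lemma 2.1(iii)(b): `4Cg₀ ≤ 1`. -/
  smallC1 : 4 * C * g₀ ≤ 1
  /-- smallness for Lemma 2.1(iii)(b): `8Cg₀(N + 1/(Ω-1)) ≤ 1`. -/
  smallC2 : 8 * C * g₀ * (N + 1 / (Ω - 1)) ≤ 1
  /-- smallness for (2.18): `2Cg₀(1 + 2C·C_{2,0}) ≤ (λ-1)/2`. -/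
  smallτ : 2 * C * g₀ * (1 + 2 * C * ((1 + N) / c + N + 2 * Ω / (Ω - 1))) ≤ (lam - 1) / 2

namespace CutoffQuadHyp

variable {P : QuadFlowParams} {Ω : ℝ} {k : ℕ∞} {B c : ℝ} {N : ℕ} {C lam g₀ : ℝ}
  (h : CutoffQuadHyp P Ω k B c N C lam g₀)
include h

/-- The constant `Z = 2C·C_{2,0}` of the bound `|z̄_j| ≤ Zχ_jḡ_j` is `≥ 0`. [cite: BauerschmidtBrydgesSlade2015Flow, Lemma 2.2, (2.15)] -/
theorem Z_nonneg : 0 ≤ 2 * C * ((1 + N) / c + N + 2 * Ω / (Ω - 1)) :=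
  mul_nonneg (mul_nonneg zero_le_two h.C_nonneg) h.toCutoffGbarHyp.C20_nonneg

/-- The smallness of Lemma 2.1(iii)(b) for the exceptional set of `ζ`. [cite: BauerschmidtBrydgesSlade2015Flow, Lemma 2.1(iii)(b)] -/
theorem smallC2' {s : Finset ℕ} (hsN : s.card ≤ N) : 8 * C * g₀ * (s.card + 1 / (Ω - 1)) ≤ 1 := by
  refine le_trans ?_ h.smallC2
  have : (s.card : ℝ) ≤ N := by exact_mod_cast hsN
  have hx : 0 ≤ 1 / (Ω - 1) := div_nonneg zero_le_one (by linarith [h.one_lt])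
  nlinarith [mul_nonneg (mul_nonneg (by norm_num : (0:ℝ) ≤ 8) h.C_nonneg) h.g₀_pos.le]

/-! ### `z̄`: convergence, the recursion, the bound `|z̄_j| ≤ Zχ_jḡ_j`, `z̄_∞ = 0`, uniqueness -/

/-- `0 ≤ Π^ζ_{j,l} ≤ 2` (Lemma 2.1(iii)(b)). [cite: BauerschmidtBrydgesSlade2015Flow, Lemma 2.1(iii)(b), (2.7)] -/
theorem zetaInvProd_mem (j l : ℕ) : P.zetaInvProd g₀ j l ∈ Set.Icc (0 : ℝ) 2 := by
  obtain ⟨s, hsN, hs⟩ := h.zeta_exc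
  have hG := h.toCutoffGbarHyp
  rw [P.zetaInvProd_eq_prod_Icc]
  refine ⟨Finset.prod_nonneg fun m _ => inv_nonneg.2 (by
    linarith [(hG.one_sub_zeta_mul_gbar_mem h.zeta_le h.smallC1 m).1]), ?_⟩
  exact hG.prod_inv_one_sub_zeta_mul_gbar_le_two s h.zeta_le hs h.smallC1 (h.smallC2' hsN) _

/-- Termwise bound for the series (2.14): `|Π^ζ_{j,l} θ_{l+j}ḡ_{l+j}²| ≤ 2C Ω^{-(l+j-k)₊}ḡ_{l+j}²`.
[cite: BauerschmidtBrydgesSlade2015Flow, Lemma 2.2, (2.15)] -/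
theorem abs_zbar_term_le (j l : ℕ) :
    |P.zetaInvProd g₀ j l * (P.θ (l + j) * gbar P.β g₀ (l + j) ^ 2)| ≤
      2 * C * (cutoffWeight Ω k (l + j) * gbar P.β g₀ (l + j) ^ 2) := by
  obtain ⟨h0, h2⟩ := h.zetaInvProd_mem j l
  rw [abs_mul, abs_of_nonneg h0, abs_mul, abs_of_nonneg (sq_nonneg (gbar P.β g₀ (l + j)))]
  have hθ := h.theta_le (l + j)
  have hw := (h.weight_pos (l + j)).le
  calc P.zetaInvProd g₀ j l * (|P.θ (l + j)| * gbar P.β g₀ (l + j) ^ 2)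
      ≤ 2 * (C * cutoffWeight Ω k (l + j) * gbar P.β g₀ (l + j) ^ 2) :=
        mul_le_mul h2 (mul_le_mul_of_nonneg_right hθ (sq_nonneg _)) (by positivity) zero_le_two
    _ = _ := by ring

/-- The series (2.14) defining `z̄_j` converges absolutely. [cite: BauerschmidtBrydgesSlade2015Flow, Lemma 2.2, (2.14)–(2.15)] -/
theorem summable_zbar_term (j : ℕ) :
    Summable fun l => P.zetaInvProd g₀ j l * (P.θ (l + j) * gbar P.β g₀ (l + j) ^ 2) :=
  Summable.of_norm_bounded ((h.summable_weight_mul_gbar_sq j).1.mul_left (2 * C)) fun l => by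
    rw [Real.norm_eq_abs]; exact h.abs_zbar_term_le j l

/-- **The `z̄`-equation**: `z̄_{j+1} = z̄_j - θ_jḡ_j² - ζ_jḡ_jz̄_j` (the `z`-component of
`V̄_{j+1} = φ̄_j(V̄_j)`). [cite: BauerschmidtBrydgesSlade2015Flow, Lemma 2.2 (proof, "z̄_{j+1} = z̄_j - ζ_jḡ_jz̄_j - θ_jḡ_j²")] -/
theorem zbar_succ (j : ℕ) :
    P.zbar g₀ (j + 1) = P.zbar g₀ j - P.θ j * gbar P.β g₀ j ^ 2 - P.ζ j * gbar P.β g₀ j * P.zbar g₀ j := by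
  have hs := h.summable_zbar_term j
  have hfac : (1 - P.ζ j * gbar P.β g₀ j) ≠ 0 := by
    linarith [(h.one_sub_zeta_mul_gbar_mem h.zeta_le h.smallC1 j).1]
  -- `z̄_j = (1 - ζ_jḡ_j)⁻¹ (θ_jḡ_j² + z̄_{j+1})`
  have key : P.zbar g₀ j =
      (1 - P.ζ j * gbar P.β g₀ j)⁻¹ * (P.θ j * gbar P.β g₀ j ^ 2 + P.zbar g₀ (j + 1)) := by
    rw [QuadFlowParams.zbar, QuadFlowParams.zbar, hs.tsum_eq_zero_add]
    simp only [zero_add, P.zetaInvProd_zero]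
    have h2 : ∑' l, P.zetaInvProd g₀ j (l + 1) * (P.θ (l + 1 + j) * gbar P.β g₀ (l + 1 + j) ^ 2) =
        (1 - P.ζ j * gbar P.β g₀ j)⁻¹ *
          ∑' l, P.zetaInvProd g₀ (j + 1) l * (P.θ (l + (j + 1)) * gbar P.β g₀ (l + (j + 1)) ^ 2) := by
      rw [← tsum_mul_left]
      exact tsum_congr fun l => by rw [P.zetaInvProd_succ, Nat.add_right_comm, Nat.add_assoc]; ring
    rw [h2]; ring
  set Z := P.zbar g₀ (j + 1) with hZ
  rw [key]
  field_simp
  ring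

/-- **`|z̄_j| ≤ Zχ_jḡ_j`**, `Z = 2C·C_{2,0}` ("`z̄_j = O(χ_jḡ_j)`", (2.15)).
[cite: BauerschmidtBrydgesSlade2015Flow, Lemma 2.2, (2.15)] [cite: BauerschmidtBrydgesSlade2015LogCorr, Proposition 6.1.1 (z̄_j = O(χ_jḡ_j))] -/
theorem abs_zbar_le (j : ℕ) :
    |P.zbar g₀ j| ≤ 2 * C * ((1 + N) / c + N + 2 * Ω / (Ω - 1)) * (cutoffWeight Ω k j * gbar P.β g₀ j) := by
  have hs := h.summable_zbar_term j
  obtain ⟨hsum, htsum⟩ := h.summable_weight_mul_gbar_sq j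
  calc |P.zbar g₀ j| ≤ ∑' l, |P.zetaInvProd g₀ j l * (P.θ (l + j) * gbar P.β g₀ (l + j) ^ 2)| := by
        have := norm_tsum_le_tsum_norm
          (f := fun l => P.zetaInvProd g₀ j l * (P.θ (l + j) * gbar P.β g₀ (l + j) ^ 2))
          (by simpa only [Real.norm_eq_abs] using hs.abs)
        simpa only [QuadFlowParams.zbar, Real.norm_eq_abs] using this
    _ ≤ ∑' l, 2 * C * (cutoffWeight Ω k (l + j) * gbar P.β g₀ (l + j) ^ 2) :=
        Summable.tsum_le_tsum (h.abs_zbar_term_le j) hs.abs (hsum.mul_left (2 * C))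
    _ = 2 * C * ∑' l, cutoffWeight Ω k (l + j) * gbar P.β g₀ (l + j) ^ 2 := tsum_mul_left
    _ ≤ 2 * C * (((1 + N) / c + N + 2 * Ω / (Ω - 1)) * (cutoffWeight Ω k j * gbar P.β g₀ j)) :=
        mul_le_mul_of_nonneg_left htsum (mul_nonneg zero_le_two h.C_nonneg)
    _ = _ := by ring

/-- `|z̄_j| ≤ Zḡ_j`. [cite: BauerschmidtBrydgesSlade2015Flow, Lemma 2.2, (2.15)] -/
theorem abs_zbar_le' (j : ℕ) :
    |P.zbar g₀ j| ≤ 2 * C * ((1 + N) / c + N + 2 * Ω / (Ω - 1)) * gbar P.β g₀ j := by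
  refine (h.abs_zbar_le j).trans (mul_le_mul_of_nonneg_left ?_ h.Z_nonneg)
  exact mul_le_of_le_one_left (h.gbar_pos j).le (h.weight_le_one j)

/-- `χ_jḡ_j → 0` (both when `k = ∞`, as `ḡ_j → 0`, and when `k < ∞`, by the weights): here from the
summability of `χ_jḡ_j²` (Lemma 2.1(ii)(a)) and `(χ_jḡ_j)² ≤ χ_jḡ_j²`.
[cite: BauerschmidtBrydgesSlade2015Flow, Remark 1.6(i) ("(1.9) implies χ_jḡ_j → 0 as j → ∞ (also when j_Ω < ∞)")] -/
theorem tendsto_weight_mul_gbar_zero : Tendsto (fun j => cutoffWeight Ω k j * gbar P.β g₀ j) atTop (𝓝 0) := by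
  have hG := h.toCutoffGbarHyp
  have hsum := (hG.summable_weight_mul_gbar_sq 0).1
  simp only [add_zero] at hsum
  have h0 : Tendsto (fun j => cutoffWeight Ω k j * gbar P.β g₀ j ^ 2) atTop (𝓝 0) :=
    hsum.tendsto_atTop_zero
  have h1 : Tendsto (fun j => (cutoffWeight Ω k j * gbar P.β g₀ j) ^ 2) atTop (𝓝 0) := by
    refine squeeze_zero (fun j => sq_nonneg _) (fun j => ?_) h0
    have hw := hG.weight_le_one j; have hw0 := (hG.weight_pos j).le; have hg := (hG.gbar_pos j).le
    calc (cutoffWeight Ω k j * gbar P.β g₀ j) ^ 2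
        = cutoffWeight Ω k j * (cutoffWeight Ω k j * gbar P.β g₀ j ^ 2) := by ring
      _ ≤ 1 * (cutoffWeight Ω k j * gbar P.β g₀ j ^ 2) :=
          mul_le_mul_of_nonneg_right hw (by positivity)
      _ = _ := one_mul _
  have h2 := (Real.continuous_sqrt.tendsto 0).comp h1
  simp only [Function.comp_def, Real.sqrt_zero] at h2
  refine h2.congr fun j => ?_
  exact Real.sqrt_sq (mul_nonneg (hG.weight_pos j).le (hG.gbar_pos j).le)

/-- **`z̄_j → 0`** (the final condition `z̄_∞ = 0`). [cite: BauerschmidtBrydgesSlade2015Flow, Lemma 2.2 (z̄_∞ = 0)] -/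
theorem tendsto_zbar_zero : Tendsto (P.zbar g₀) atTop (𝓝 0) := by
  refine squeeze_zero_norm (fun j => (Real.norm_eq_abs _).trans_le (h.abs_zbar_le j)) ?_
  simpa using h.tendsto_weight_mul_gbar_zero.const_mul (2 * C * ((1 + N) / c + N + 2 * Ω / (Ω - 1)))

/-- **Uniqueness for `z̄`**: any solution of the `z̄`-equation tending to `0` is `z̄` (the homogeneous
solutions `d₀∏_{i<j}(1 - ζ_iḡ_i)` do not decay, by Lemma 2.1(iii)(b)).
[cite: BauerschmidtBrydgesSlade2015Flow, Lemma 2.2 ("the unique solution … which obeys z̄_∞ = 0")] -/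
theorem zbar_unique {z : ℕ → ℝ}
    (hz : ∀ j, z (j + 1) = z j - P.θ j * gbar P.β g₀ j ^ 2 - P.ζ j * gbar P.β g₀ j * z j)
    (hz0 : Tendsto z atTop (𝓝 0)) : z = P.zbar g₀ := by
  obtain ⟨s, hsN, hs⟩ := h.zeta_exc
  have hG := h.toCutoffGbarHyp
  set d : ℕ → ℝ := fun j => z j - P.zbar g₀ j with hd
  have hstep : ∀ j, d (j + 1) = (1 - P.ζ j * gbar P.β g₀ j) * d j := fun j => by
    simp only [hd, hz j, h.zbar_succ j]; ring
  have hprod : ∀ j, d j = d 0 * ∏ i ∈ Finset.range j, (1 - P.ζ i * gbar P.β g₀ i) := by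
    intro j
    induction j with
    | zero => simp
    | succ j ih => rw [hstep, ih, Finset.prod_range_succ]; ring
  have hlow : ∀ j, |d 0| / 2 ≤ |d j| := fun j => by
    rw [hprod j, abs_mul, abs_of_pos (a := ∏ i ∈ Finset.range j, (1 - P.ζ i * gbar P.β g₀ i))
      (Finset.prod_pos fun i _ => by linarith [(hG.one_sub_zeta_mul_gbar_mem h.zeta_le h.smallC1 i).1])]
    have := hG.half_le_prod_one_sub_zeta_mul_gbar s h.zeta_le hs h.smallC1 (h.smallC2' hsN)
      (Finset.range j)
    have h0 := abs_nonneg (d 0)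
    calc |d 0| / 2 = |d 0| * (1 / 2) := by ring
      _ ≤ _ := mul_le_mul_of_nonneg_left this h0
  have hdlim : Tendsto d atTop (𝓝 0) := by simpa using hz0.sub h.tendsto_zbar_zero
  have hd0 : d 0 = 0 := by
    by_contra hne
    have hpos : 0 < |d 0| / 2 := by positivity
    have hev := (Metric.tendsto_nhds.1 hdlim) (|d 0| / 2) hpos
    obtain ⟨j, hj⟩ := hev.exists
    rw [dist_zero_right, Real.norm_eq_abs] at hj
    linarith [hlow j]
  funext j
  have := hprod j
  rw [hd0, zero_mul] at this
  simpa [hd, sub_eq_zero] using this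

/-! ### `μ̄`: the multipliers `λ_j - τ_j`, convergence, the recursion, the bound, `μ̄_∞ = 0`, uniqueness -/

/-- `|τ_j| ≤ (λ-1)/2` (smallness `smallτ`). [cite: BauerschmidtBrydgesSlade2015Flow, Lemma 2.2, (2.18)] -/
theorem abs_tau_le (j : ℕ) : |P.tau g₀ j| ≤ (lam - 1) / 2 := by
  have hG := h.toCutoffGbarHyp
  have hw := hG.weight_le_one j; have hw0 := (hG.weight_pos j).le
  have hg := hG.gbar_le_two_mul_init j; have hgp := (hG.gbar_pos j).le
  have hz := h.abs_zbar_le' j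
  have hC := h.C_nonneg
  set Z := 2 * C * ((1 + N) / c + N + 2 * Ω / (Ω - 1)) with hZ
  have hZ0 : 0 ≤ Z := h.Z_nonneg
  unfold QuadFlowParams.tau
  calc |P.υgμ j * gbar P.β g₀ j + P.υzμ j * P.zbar g₀ j|
      ≤ |P.υgμ j| * gbar P.β g₀ j + |P.υzμ j| * |P.zbar g₀ j| := by
        refine (abs_add_le _ _).trans (le_of_eq ?_)
        rw [abs_mul, abs_of_nonneg hgp, abs_mul]
    _ ≤ C * (2 * g₀) + C * (Z * (2 * g₀)) := by
        refine add_le_add ?_ ?_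
        · exact mul_le_mul ((h.υgμ_le j).trans (mul_le_of_le_one_right hC hw)) hg hgp hC
        · calc |P.υzμ j| * |P.zbar g₀ j| ≤ C * (Z * gbar P.β g₀ j) :=
              mul_le_mul ((h.υzμ_le j).trans (mul_le_of_le_one_right hC hw)) hz (abs_nonneg _) hC
            _ ≤ C * (Z * (2 * g₀)) := by gcongr
    _ = 2 * C * g₀ * (1 + Z) := by ring
    _ ≤ (lam - 1) / 2 := h.smallτ

/-- `λ_j - τ_j ≥ (1+λ)/2 > 1` ((2.18): `(λ_j - τ_j)⁻¹ ≤ α < 1`).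
[cite: BauerschmidtBrydgesSlade2015Flow, Lemma 2.2, (2.18)] -/
theorem lam_sub_tau_ge (j : ℕ) : (1 + lam) / 2 ≤ P.lam j - P.tau g₀ j := by
  have := h.abs_tau_le j; have := h.lam_le j
  linarith [le_abs_self (P.tau g₀ j)]

/-- `0 ≤ (λ_j - τ_j)⁻¹ ≤ 2/(1+λ)`. [cite: BauerschmidtBrydgesSlade2015Flow, Lemma 2.2, (2.18)] -/
theorem inv_lam_sub_tau_mem (j : ℕ) : (P.lam j - P.tau g₀ j)⁻¹ ∈ Set.Icc (0 : ℝ) (2 / (1 + lam)) := by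
  have h1 := h.lam_sub_tau_ge j; have h2 := h.one_lt_lam
  have hpos : 0 < P.lam j - P.tau g₀ j := by linarith
  refine ⟨inv_nonneg.2 hpos.le, ?_⟩
  rw [inv_le_comm₀ hpos (by positivity), inv_div]
  exact h1

/-- `0 ≤ α = 2/(1+λ) < 1`. [cite: BauerschmidtBrydgesSlade2015Flow, Lemma 2.2, (2.18)] -/
theorem alpha_mem : (2 / (1 + lam) : ℝ) ∈ Set.Ico (0 : ℝ) 1 := by
  have := h.one_lt_lam
  exact ⟨by positivity, by rw [div_lt_one (by linarith)]; linarith⟩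

/-- `0 ≤ ∏_{k=j}^{j+l} (λ_k - τ_k)⁻¹ ≤ α^{l+1}`, `α = 2/(1+λ)`. [cite: BauerschmidtBrydgesSlade2015Flow, Lemma 2.2 (proof: |μ̄_j| ≤ Σ α^{l-j+1} O(χ_lḡ_l))] -/
theorem lamInvProd_mem (j l : ℕ) : P.lamInvProd g₀ j l ∈ Set.Icc (0 : ℝ) ((2 / (1 + lam)) ^ (l + 1)) := by
  unfold QuadFlowParams.lamInvProd
  refine ⟨Finset.prod_nonneg fun i _ => (h.inv_lam_sub_tau_mem _).1, ?_⟩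
  calc ∏ i ∈ Finset.range (l + 1), (P.lam (i + j) - P.tau g₀ (i + j))⁻¹
      ≤ ∏ _i ∈ Finset.range (l + 1), (2 / (1 + lam) : ℝ) :=
        Finset.prod_le_prod (fun i _ => (h.inv_lam_sub_tau_mem _).1) fun i _ => (h.inv_lam_sub_tau_mem _).2
    _ = (2 / (1 + lam)) ^ (l + 1) := by rw [Finset.prod_const, Finset.card_range]

/-- The constant `K_σ = C(3 + 3Z + Z²)/2` with `|σ_l| ≤ K_σ Ω^{-(l-k)₊}ḡ_l` (`Z = 2C·C_{2,0}`).
[cite: BauerschmidtBrydgesSlade2015Flow, Lemma 2.2 (proof: "σ_j ≤ O(χ_jḡ_j)")] -/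
theorem abs_sigma_le (l : ℕ) :
    |P.sigma g₀ l| ≤
      C * (3 + 3 * (2 * C * ((1 + N) / c + N + 2 * Ω / (Ω - 1))) +
          (2 * C * ((1 + N) / c + N + 2 * Ω / (Ω - 1))) ^ 2) / 2 *
        (cutoffWeight Ω k l * gbar P.β g₀ l) := by
  have hG := h.toCutoffGbarHyp
  set Z := 2 * C * ((1 + N) / c + N + 2 * Ω / (Ω - 1)) with hZ
  set w := cutoffWeight Ω k l with hw
  set g := gbar P.β g₀ l with hg
  have hZ0 : 0 ≤ Z := h.Z_nonneg
  have hC := h.C_nonneg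
  have hw1 : w ≤ 1 := hG.weight_le_one l
  have hw0 : 0 ≤ w := (hG.weight_pos l).le
  have hgp : 0 ≤ g := (hG.gbar_pos l).le
  have hg2 : g ≤ 1 / 2 := hG.gbar_le_half l
  have hz : |P.zbar g₀ l| ≤ Z * (w * g) := h.abs_zbar_le l
  have hzg : |P.zbar g₀ l| ≤ Z * g := h.abs_zbar_le' l
  -- the five terms
  have t1 : |P.η l * g| ≤ C * w * g := by
    rw [abs_mul, abs_of_nonneg hgp]; exact mul_le_mul_of_nonneg_right (h.eta_le l) hgp
  have t2 : |P.γ l * P.zbar g₀ l| ≤ C * (Z * (w * g)) := by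
    rw [abs_mul]
    exact mul_le_mul ((h.gamma_le l).trans (mul_le_of_le_one_right hC hw1)) hz (abs_nonneg _) hC
  have t3 : |P.υgg l * g ^ 2| ≤ C * w * g * (1 / 2) := by
    rw [abs_mul, abs_of_nonneg (sq_nonneg g), sq, ← mul_assoc]
    exact mul_le_mul (mul_le_mul_of_nonneg_right (h.υgg_le l) hgp) hg2 hgp (by positivity)
  have t4 : |P.υgz l * g * P.zbar g₀ l| ≤ C * w * g * (Z * (1 / 2)) := by
    rw [abs_mul, abs_mul, abs_of_nonneg hgp]
    refine mul_le_mul (mul_le_mul_of_nonneg_right (h.υgz_le l) hgp) (hzg.trans ?_) (abs_nonneg _)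
      (by positivity)
    exact mul_le_mul_of_nonneg_left hg2 hZ0
  have t5 : |P.υzz l * P.zbar g₀ l ^ 2| ≤ C * (Z * (w * g)) * (Z * (1 / 2)) := by
    rw [abs_mul, abs_pow, sq, ← mul_assoc]
    refine mul_le_mul ?_ (hzg.trans (mul_le_mul_of_nonneg_left hg2 hZ0)) (abs_nonneg _) (by positivity)
    exact mul_le_mul ((h.υzz_le l).trans (mul_le_of_le_one_right hC hw1)) hz (abs_nonneg _) hC
  unfold QuadFlowParams.sigma
  rw [← hg]
  calc |P.η l * g + P.γ l * P.zbar g₀ l - P.υgg l * g ^ 2 - P.υgz l * g * P.zbar g₀ l -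
          P.υzz l * P.zbar g₀ l ^ 2|
      ≤ |P.η l * g| + |P.γ l * P.zbar g₀ l| + |P.υgg l * g ^ 2| + |P.υgz l * g * P.zbar g₀ l| +
          |P.υzz l * P.zbar g₀ l ^ 2| := by
        refine (abs_sub _ _).trans (add_le_add ((abs_sub _ _).trans (add_le_add ((abs_sub _ _).trans
          (add_le_add (abs_add_le _ _) le_rfl)) le_rfl)) le_rfl)
    _ ≤ C * w * g + C * (Z * (w * g)) + C * w * g * (1 / 2) + C * w * g * (Z * (1 / 2)) +
          C * (Z * (w * g)) * (Z * (1 / 2)) := by linarith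
    _ = C * (3 + 3 * Z + Z ^ 2) / 2 * (w * g) := by ring

/-- `K_σ ≥ 0`. [cite: BauerschmidtBrydgesSlade2015Flow, Lemma 2.2 (proof)] -/
theorem Ksigma_nonneg :
    0 ≤ C * (3 + 3 * (2 * C * ((1 + N) / c + N + 2 * Ω / (Ω - 1))) +
      (2 * C * ((1 + N) / c + N + 2 * Ω / (Ω - 1))) ^ 2) / 2 := by
  have := h.Z_nonneg; have := h.C_nonneg; positivity

/-- Termwise bound for the series (2.19): `|∏(λ-τ)⁻¹ σ_{l+j}| ≤ 2K_σ χ_jḡ_j α^{l+1}`.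
[cite: BauerschmidtBrydgesSlade2015Flow, Lemma 2.2 (proof: |μ̄_j| ≤ Σ_{l≥j} α^{l-j+1}O(χ_lḡ_l))] -/
theorem abs_mubar_term_le (j l : ℕ) :
    |P.lamInvProd g₀ j l * P.sigma g₀ (l + j)| ≤
      2 * (C * (3 + 3 * (2 * C * ((1 + N) / c + N + 2 * Ω / (Ω - 1))) +
          (2 * C * ((1 + N) / c + N + 2 * Ω / (Ω - 1))) ^ 2) / 2) *
        (cutoffWeight Ω k j * gbar P.β g₀ j) * (2 / (1 + lam)) ^ (l + 1) := by
  have hG := h.toCutoffGbarHyp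
  obtain ⟨hP0, hP1⟩ := h.lamInvProd_mem j l
  have hK := h.Ksigma_nonneg
  set K := C * (3 + 3 * (2 * C * ((1 + N) / c + N + 2 * Ω / (Ω - 1))) +
      (2 * C * ((1 + N) / c + N + 2 * Ω / (Ω - 1))) ^ 2) / 2 with hKdef
  rw [abs_mul, abs_of_nonneg hP0]
  have hmono : cutoffWeight Ω k (l + j) * gbar P.β g₀ (l + j) ≤
      2 * (cutoffWeight Ω k j * gbar P.β g₀ j) := by
    have h1 := hG.gbar_le_two_mul (Nat.le_add_left j l)
    have h2 := cutoffWeight_antitone hG.one_le k (Nat.le_add_left j l)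
    calc cutoffWeight Ω k (l + j) * gbar P.β g₀ (l + j) ≤ cutoffWeight Ω k j * (2 * gbar P.β g₀ j) :=
          mul_le_mul h2 h1 (hG.gbar_pos _).le (hG.weight_pos j).le
      _ = _ := by ring
  calc P.lamInvProd g₀ j l * |P.sigma g₀ (l + j)|
      ≤ (2 / (1 + lam)) ^ (l + 1) * (K * (2 * (cutoffWeight Ω k j * gbar P.β g₀ j))) := by
        refine mul_le_mul hP1 ((h.abs_sigma_le _).trans ?_) (abs_nonneg _)
          (pow_nonneg h.alpha_mem.1 _)
        exact mul_le_mul_of_nonneg_left hmono hK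
    _ = _ := by rw [hKdef]; ring

/-- The series (2.19) defining `μ̄_j` converges (geometrically). [cite: BauerschmidtBrydgesSlade2015Flow, Lemma 2.2 ("geometric convergence of the sum is guaranteed by (2.18)")] -/
theorem summable_mubar_term (j : ℕ) : Summable fun l => P.lamInvProd g₀ j l * P.sigma g₀ (l + j) := by
  obtain ⟨hα0, hα1⟩ := h.alpha_mem
  set K := C * (3 + 3 * (2 * C * ((1 + N) / c + N + 2 * Ω / (Ω - 1))) +
      (2 * C * ((1 + N) / c + N + 2 * Ω / (Ω - 1))) ^ 2) / 2
  refine Summable.of_norm_bounded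
    (((summable_geometric_of_lt_one hα0 hα1).mul_left
      (2 * K * (cutoffWeight Ω k j * gbar P.β g₀ j) * (2 / (1 + lam))))) fun l => ?_
  rw [Real.norm_eq_abs]
  refine (h.abs_mubar_term_le j l).trans_eq ?_
  ring

/-- **The `μ̄`-equation**: `μ̄_{j+1} = (λ_j - τ_j)μ̄_j + σ_j`, i.e.
`μ̄_{j+1} = η_jḡ_j + γ_jz̄_j + λ_jμ̄_j - υ^{gg}ḡ_j² - υ^{gz}ḡ_jz̄_j - υ^{gμ}ḡ_jμ̄_j - υ^{zz}z̄_j² - υ^{zμ}z̄_jμ̄_j`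
(the `μ`-component of `V̄_{j+1} = φ̄_j(V̄_j)`). [cite: BauerschmidtBrydgesSlade2015Flow, Lemma 2.2, (2.16)–(2.17)] -/
theorem mubar_succ (j : ℕ) :
    P.mubar g₀ (j + 1) = (P.lam j - P.tau g₀ j) * P.mubar g₀ j + P.sigma g₀ j := by
  have hs := h.summable_mubar_term j
  have hΛ : P.lam j - P.tau g₀ j ≠ 0 := by linarith [h.lam_sub_tau_ge j, h.one_lt_lam]
  have key : P.mubar g₀ j = (P.lam j - P.tau g₀ j)⁻¹ * (P.mubar g₀ (j + 1) - P.sigma g₀ j) := by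
    rw [QuadFlowParams.mubar, QuadFlowParams.mubar, hs.tsum_eq_zero_add]
    simp only [zero_add, P.lamInvProd_zero]
    have h2 : ∑' l, P.lamInvProd g₀ j (l + 1) * P.sigma g₀ (l + 1 + j) =
        (P.lam j - P.tau g₀ j)⁻¹ * ∑' l, P.lamInvProd g₀ (j + 1) l * P.sigma g₀ (l + (j + 1)) := by
      rw [← tsum_mul_left]
      exact tsum_congr fun l => by rw [P.lamInvProd_succ, Nat.add_right_comm, Nat.add_assoc]; ring
    rw [h2]; ring
  set M := P.mubar g₀ (j + 1)
  rw [key]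
  field_simp
  ring

/-- **`|μ̄_j| ≤ (4K_σ/(λ-1)) χ_jḡ_j`** ("`μ̄_j = O(χ_jḡ_j)`", (2.21)).
[cite: BauerschmidtBrydgesSlade2015Flow, Lemma 2.2, (2.20)–(2.21)] [cite: BauerschmidtBrydgesSlade2015LogCorr, Proposition 6.1.1 (μ̄_j = O(χ_jḡ_j))] -/
theorem abs_mubar_le (j : ℕ) :
    |P.mubar g₀ j| ≤
      4 * (C * (3 + 3 * (2 * C * ((1 + N) / c + N + 2 * Ω / (Ω - 1))) +
          (2 * C * ((1 + N) / c + N + 2 * Ω / (Ω - 1))) ^ 2) / 2) / (lam - 1) *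
        (cutoffWeight Ω k j * gbar P.β g₀ j) := by
  have hs := h.summable_mubar_term j
  have hlam := h.one_lt_lam
  obtain ⟨hα0, hα1⟩ := h.alpha_mem
  set K := C * (3 + 3 * (2 * C * ((1 + N) / c + N + 2 * Ω / (Ω - 1))) +
      (2 * C * ((1 + N) / c + N + 2 * Ω / (Ω - 1))) ^ 2) / 2 with hK
  set X := cutoffWeight Ω k j * gbar P.β g₀ j with hX
  set α : ℝ := 2 / (1 + lam) with hα
  have hgeo : HasSum (fun l : ℕ => 2 * K * X * α ^ (l + 1)) (4 * K / (lam - 1) * X) := by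
    have h1 := (hasSum_geometric_of_lt_one hα0 hα1).mul_left (2 * K * X * α)
    have hfun : (fun l : ℕ => 2 * K * X * α ^ (l + 1)) = fun l => 2 * K * X * α * α ^ l := by
      funext l; ring
    have hval : 2 * K * X * α * (1 - α)⁻¹ = 4 * K / (lam - 1) * X := by
      have hne1 : (lam - 1) ≠ 0 := by linarith
      have hne2 : (1 + lam) ≠ 0 := by linarith
      have h1α' : 1 - α = (lam - 1) / (1 + lam) := by
        rw [hα, eq_div_iff hne2, sub_mul, div_mul_cancel₀ _ hne2]; ring
      have h1α : (1 - α)⁻¹ = (1 + lam) / (lam - 1) := by rw [h1α', inv_div]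
      rw [h1α, hα, mul_assoc (2 * K * X), div_mul_div_comm, mul_comm 2 (1 + lam), ← div_mul_div_comm,
        div_self hne2, one_mul]
      ring
    rw [hfun, ← hval]
    exact h1
  rw [QuadFlowParams.mubar, abs_neg]
  calc |∑' l, P.lamInvProd g₀ j l * P.sigma g₀ (l + j)|
      ≤ ∑' l, |P.lamInvProd g₀ j l * P.sigma g₀ (l + j)| := by
        have := norm_tsum_le_tsum_norm (f := fun l => P.lamInvProd g₀ j l * P.sigma g₀ (l + j))
          (by simpa only [Real.norm_eq_abs] using hs.abs)
        simpa only [Real.norm_eq_abs] using this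
    _ ≤ ∑' l : ℕ, 2 * K * X * α ^ (l + 1) :=
        Summable.tsum_le_tsum (fun l => h.abs_mubar_term_le j l) hs.abs hgeo.summable
    _ = 4 * K / (lam - 1) * X := hgeo.tsum_eq

/-- **`μ̄_j → 0`** (the final condition `μ̄_∞ = 0`). [cite: BauerschmidtBrydgesSlade2015Flow, Lemma 2.2 (μ̄_∞ = 0)] -/
theorem tendsto_mubar_zero : Tendsto (P.mubar g₀) atTop (𝓝 0) := by
  refine squeeze_zero_norm (fun j => (Real.norm_eq_abs _).trans_le (h.abs_mubar_le j)) ?_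
  simpa using h.tendsto_weight_mul_gbar_zero.const_mul
    (4 * (C * (3 + 3 * (2 * C * ((1 + N) / c + N + 2 * Ω / (Ω - 1))) +
      (2 * C * ((1 + N) / c + N + 2 * Ω / (Ω - 1))) ^ 2) / 2) / (lam - 1))

/-- **Uniqueness for `μ̄`**: a BOUNDED solution of `μ_{j+1} = (λ_j - τ_j)μ_j + σ_j` (in particular
one tending to `0`) is `μ̄` — the `μ`-direction is expanding: differences grow at least like
`((1+λ)/2)^n`. [cite: BauerschmidtBrydgesSlade2015Flow, Lemma 2.2 ("the unique solution which obeys the boundary condition μ_∞ = 0")] -/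
theorem mubar_unique {μ : ℕ → ℝ} (hμ : ∀ j, μ (j + 1) = (P.lam j - P.tau g₀ j) * μ j + P.sigma g₀ j)
    (hbdd : ∃ M, ∀ j, |μ j| ≤ M) : μ = P.mubar g₀ := by
  have hG := h.toCutoffGbarHyp
  obtain ⟨M, hM⟩ := hbdd
  have hlam := h.one_lt_lam
  set ρ : ℝ := (1 + lam) / 2 with hρ
  have hρ1 : 1 < ρ := by rw [hρ]; linarith
  set d : ℕ → ℝ := fun j => μ j - P.mubar g₀ j with hd
  have hstep : ∀ j, d (j + 1) = (P.lam j - P.tau g₀ j) * d j := fun j => by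
    simp only [hd, hμ j, h.mubar_succ j]; ring
  have hgrow : ∀ j n, ρ ^ n * |d j| ≤ |d (j + n)| := by
    intro j n
    induction n with
    | zero => simp
    | succ n ih =>
      have hge := h.lam_sub_tau_ge (j + n)
      rw [← Nat.add_assoc, hstep, abs_mul,
        abs_of_nonneg (show (0 : ℝ) ≤ P.lam (j + n) - P.tau g₀ (j + n) by linarith), pow_succ]
      calc ρ ^ n * ρ * |d j| = ρ * (ρ ^ n * |d j|) := by ring
        _ ≤ (P.lam (j + n) - P.tau g₀ (j + n)) * |d (j + n)| :=
          mul_le_mul hge ih (by positivity) (by linarith)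
  -- `|d_i|` is bounded
  set K' := 4 * (C * (3 + 3 * (2 * C * ((1 + N) / c + N + 2 * Ω / (Ω - 1))) +
      (2 * C * ((1 + N) / c + N + 2 * Ω / (Ω - 1))) ^ 2) / 2) / (lam - 1) with hK'
  have hK'0 : 0 ≤ K' := by have := h.Ksigma_nonneg; rw [hK']; positivity
  have hbd : ∀ i, |d i| ≤ M + K' := fun i => by
    have hX : cutoffWeight Ω k i * gbar P.β g₀ i ≤ 1 := by
      have := hG.weight_le_one i; have := hG.gbar_le_half i
      have := (hG.weight_pos i).le; have := (hG.gbar_pos i).le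
      nlinarith
    calc |d i| ≤ |μ i| + |P.mubar g₀ i| := abs_sub _ _
      _ ≤ M + K' * (cutoffWeight Ω k i * gbar P.β g₀ i) := add_le_add (hM i) (h.abs_mubar_le i)
      _ ≤ M + K' * 1 := by gcongr
      _ = M + K' := by ring
  funext j
  by_contra hne
  have hdj : 0 < |d j| := abs_pos.2 (sub_ne_zero.2 hne)
  have hpow : Tendsto (fun n : ℕ => ρ ^ n * |d j|) atTop atTop :=
    (tendsto_pow_atTop_atTop_of_one_lt hρ1).atTop_mul_const hdj
  obtain ⟨n, hn⟩ := (hpow.eventually_gt_atTop (M + K')).exists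
  exact absurd ((hgrow j n).trans (hbd (j + n))) (not_le.2 hn)

/-! ### The global flow `V̄ = (ḡ, z̄, μ̄)`: existence with the boundary conditions, uniqueness -/

/-- **[BBS-rg-flow, Lemma 2.2 / Proposition 1.2, existence]**: `V̄ = (ḡ, z̄, μ̄)` is a global flow of
`φ̄` with initial condition `ḡ₀ = g₀` and final condition `(z̄_∞, μ̄_∞) = (0,0)`.
[cite: BauerschmidtBrydgesSlade2015Flow, Lemma 2.2 and Proposition 1.2] [cite: BauerschmidtBrydgesSlade2015LogCorr, Proposition 6.1.1] -/
theorem isQuadFlowBC_flow : IsQuadFlowBC P g₀ (P.flow g₀) := by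
  refine ⟨fun j => ?_, by simp [QuadFlowParams.flow], ?_, ?_⟩
  · ext i
    fin_cases i
    · simp [QuadFlowParams.flow, gbar_succ]
    · show P.zbar g₀ (j + 1) = P.map j (P.flow g₀ j) 1
      rw [QuadFlowParams.map_apply_one, h.zbar_succ]
      simp only [QuadFlowParams.flow, Matrix.cons_val_zero, Matrix.cons_val_one]
      ring
    · show P.mubar g₀ (j + 1) = P.map j (P.flow g₀ j) 2
      rw [QuadFlowParams.map_apply_two, h.mubar_succ, QuadFlowParams.tau, QuadFlowParams.sigma]
      simp only [QuadFlowParams.flow, Matrix.cons_val_zero, Matrix.cons_val_one, Matrix.head_cons,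
        Matrix.cons_val_two, Matrix.tail_cons]
      ring
  · simpa [QuadFlowParams.flow] using h.tendsto_zbar_zero
  · simpa [QuadFlowParams.flow] using h.tendsto_mubar_zero

/-- **[BBS-rg-flow, Lemma 2.2 / Proposition 1.2, uniqueness]**: a global flow of `φ̄` with `ḡ₀ = g₀`
and `(z̄_∞, μ̄_∞) = (0,0)` is `V̄ = (ḡ, z̄, μ̄)`.
[cite: BauerschmidtBrydgesSlade2015Flow, Lemma 2.2 and Proposition 1.2 ("unique global flow")]
[cite: BauerschmidtBrydgesSlade2015LogCorr, Proposition 6.1.1] -/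
theorem eq_flow_of_isQuadFlowBC {Vb : ℕ → V3} (hV : IsQuadFlowBC P g₀ Vb) : Vb = P.flow g₀ := by
  obtain ⟨hflow, h0, hz, hμ⟩ := hV
  -- `g`-component
  have hg : ∀ j, Vb j 0 = gbar P.β g₀ j := fun j => by
    rw [QuadFlowParams.flow_apply_zero_eq_gbar hflow j, h0]
  -- `z`-component
  have hz' : (fun j => Vb j 1) = P.zbar g₀ := by
    refine h.zbar_unique (fun j => ?_) hz
    have := congrFun (hflow j) 1
    rw [QuadFlowParams.map_apply_one, hg j] at this
    rw [this]; ring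
  have hz'' : ∀ j, Vb j 1 = P.zbar g₀ j := fun j => congrFun hz' j
  -- `μ`-component: bounded since convergent
  have hμ' : (fun j => Vb j 2) = P.mubar g₀ := by
    refine h.mubar_unique (fun j => ?_) ?_
    · have := congrFun (hflow j) 2
      rw [QuadFlowParams.map_apply_two, hg j, hz'' j] at this
      rw [this, QuadFlowParams.tau, QuadFlowParams.sigma]; ring
    · obtain ⟨R, hR⟩ := (Metric.isBounded_range_of_tendsto _ hμ).subset_closedBall 0
      exact ⟨R, fun j => by simpa [Real.norm_eq_abs] using hR (Set.mem_range_self j)⟩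
  have hμ'' : ∀ j, Vb j 2 = P.mubar g₀ j := fun j => congrFun hμ' j
  funext j
  ext i
  fin_cases i
  · simpa [QuadFlowParams.flow] using hg j
  · simpa [QuadFlowParams.flow] using hz'' j
  · simpa [QuadFlowParams.flow] using hμ'' j

end CutoffQuadHyp


/-! ## From Assumptions (A1)–(A2) to the hypotheses above; [BBS-rg-flow, Proposition 1.2] -/

/-- The constant `C_{2,0}(Ω, c, N) = (1+N)/c + N + 2Ω/(Ω-1)` of (2.3) with `(n,m) = (2,0)`.
[cite: BauerschmidtBrydgesSlade2015Flow, Lemma 2.1(ii)(a), (2.3)] -/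
def sumSqConst (Ω c : ℝ) (N : ℕ) : ℝ := (1 + N) / c + N + 2 * Ω / (Ω - 1)

/-- An explicit threshold `g₁(Ω, B, c, C, λ) > 0` below which all the smallness conditions of
`CutoffQuadHyp` and of Lemma 2.1(ii)(b) hold ("if `ḡ₀ > 0` is sufficiently small", with all constants
depending only on the constants of (A1)–(A2) and `Ω`):
`g₁ = (8(1+B+c+C)(1+N+1/(Ω-1))(1+2C·C_{2,0})(1+2/(λ-1)))⁻¹`, `N = ⌊c⁻¹⌋`, with `B, C` replaced by
their positive parts. [cite: BauerschmidtBrydgesSlade2015Flow, Proposition 1.2 and Lemma 2.2 ("if ḡ₀ is sufficiently small")] -/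
def quadThreshold (Ω B c C lam : ℝ) : ℝ :=
  (8 * (1 + max B 0 + c + max C 0) * ((1 + ⌊c⁻¹⌋₊ + 1 / (Ω - 1)) *
    ((1 + 2 * max C 0 * sumSqConst Ω c ⌊c⁻¹⌋₊) * (1 + 2 / (lam - 1)))))⁻¹

/-- `C_{2,0} ≥ 0` for `Ω > 1`, `c > 0`. [cite: BauerschmidtBrydgesSlade2015Flow, Lemma 2.1(ii)(a)] -/
theorem sumSqConst_nonneg {Ω c : ℝ} (hΩ : 1 < Ω) (hc : 0 < c) (N : ℕ) : 0 ≤ sumSqConst Ω c N := by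
  unfold sumSqConst
  have : 0 ≤ 2 * Ω / (Ω - 1) := div_nonneg (by linarith) (by linarith)
  positivity

/-- The threshold is positive. [cite: BauerschmidtBrydgesSlade2015Flow, Proposition 1.2] -/
theorem quadThreshold_pos {Ω B c C lam : ℝ} (hΩ : 1 < Ω) (hc : 0 < c) (hlam : 1 < lam) :
    0 < quadThreshold Ω B c C lam := by
  unfold quadThreshold
  have h1 : 0 < 1 / (Ω - 1) := div_pos one_pos (by linarith)
  have h2 : 0 < 2 / (lam - 1) := div_pos two_pos (by linarith)
  have h3 := sumSqConst_nonneg hΩ hc ⌊c⁻¹⌋₊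
  have h4 : 0 ≤ max B 0 := le_max_right _ _
  have h5 : 0 ≤ max C 0 := le_max_right _ _
  positivity

/-- **Assumptions (A1)–(A2) imply the hypotheses of Lemmas 2.1–2.2** at the cut-off `k = j_Ω`, with
`N = ⌊c⁻¹⌋` exceptional scales, for every `0 < g₀ ≤ g₁(Ω, B, c, C, λ)`, together with the extra
smallness `cg₀ ≤ 1/4`, `2N(2B+c)g₀ ≤ 1/2` of Lemma 2.1(ii)(b).
[cite: BauerschmidtBrydgesSlade2015Flow, Assumptions (A1)–(A2), Proposition 1.2] -/
theorem cutoffQuadHyp_of_hypA {P : QuadFlowParams} {Ω B c lam C : ℝ} (hΩ : 1 < Ω)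
    (hA1 : HypA1 P.β Ω B c) (hA2 : HypA2 P Ω lam c C) {g₀ : ℝ} (hg₀ : 0 < g₀)
    (hsmall : g₀ ≤ quadThreshold Ω B c C lam) :
    CutoffQuadHyp P Ω (jOmega P.β Ω) B c ⌊c⁻¹⌋₊ C lam g₀ ∧ c * g₀ ≤ 1 / 4 ∧
      2 * (⌊c⁻¹⌋₊ : ℝ) * (2 * B + c) * g₀ ≤ 1 / 2 := by
  have hB : 0 ≤ B := hA1.B_nonneg
  have hc : 0 < c := hA1.c_pos
  have hlam : 1 < lam := hA2.one_lt_lam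
  have hC : 0 ≤ C := by
    have h1 := hA2.eta_le 0
    have h2 := (chi_pos_and_le_one P.β hΩ.le 0).1
    by_contra hC
    have : C * chi P.β Ω 0 < 0 := mul_neg_of_neg_of_pos (lt_of_not_ge hC) h2
    linarith [abs_nonneg (P.η 0)]
  set N : ℕ := ⌊c⁻¹⌋₊ with hN
  set x : ℝ := 1 / (Ω - 1) with hx
  have hx0 : 0 < x := div_pos one_pos (by linarith)
  set S := sumSqConst Ω c N with hS
  have hS0 : 0 ≤ S := sumSqConst_nonneg hΩ hc N
  set F1 : ℝ := 1 + B + c + C with hF1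
  set F2 : ℝ := 1 + N + x with hF2
  set F3 : ℝ := 1 + 2 * C * S with hF3
  set F4 : ℝ := 1 + 2 / (lam - 1) with hF4
  have hN0 : (0 : ℝ) ≤ N := Nat.cast_nonneg N
  have hF1' : 1 ≤ F1 := by rw [hF1]; linarith
  have hF2' : 1 ≤ F2 := by rw [hF2]; linarith
  have hCS : 0 ≤ 2 * C * S := by positivity
  have hF3' : 1 ≤ F3 := by rw [hF3]; linarith
  have hF4pos : 0 < 2 / (lam - 1) := div_pos two_pos (by linarith)
  have hF4' : 1 ≤ F4 := by rw [hF4]; linarith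
  have hF10 : 0 ≤ F1 := by linarith
  have hF20 : 0 ≤ F2 := by linarith
  have hF30 : 0 ≤ F3 := by linarith
  have hF40 : 0 ≤ F4 := by linarith
  set W : ℝ := F2 * (F3 * F4) with hW
  have hP34 : 1 ≤ F3 * F4 := one_le_mul_of_one_le_of_one_le hF3' hF4'
  have hW1 : 1 ≤ W := one_le_mul_of_one_le_of_one_le hF2' hP34
  have hW0 : 0 ≤ W := by linarith
  have hF2W : F2 ≤ W := le_mul_of_one_le_right hF20 hP34
  have hF1W : F1 ≤ F1 * W := le_mul_of_one_le_right hF10 hW1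
  have hthr : quadThreshold Ω B c C lam = (8 * F1 * W)⁻¹ := by
    unfold quadThreshold
    rw [max_eq_left hB, max_eq_left hC, hW, mul_assoc]
  set D : ℝ := 8 * F1 * W with hD
  have hDpos : 0 < D := by
    have : (8 : ℝ) ≤ D := by rw [hD]; nlinarith
    linarith
  have key : g₀ * D ≤ 1 := by
    have : g₀ ≤ D⁻¹ := by rw [← hthr]; exact hsmall
    rwa [le_inv_comm₀ hg₀ hDpos, ← one_div, le_div_iff₀ hg₀, mul_comm] at this
  -- each smallness condition has the form `q · g₀ ≤ r` and follows from `q ≤ r · D`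
  have aux : ∀ {q r : ℝ}, 0 ≤ r → q ≤ r * D → q * g₀ ≤ r := fun {q r} hr hq => by
    calc q * g₀ ≤ r * D * g₀ := mul_le_mul_of_nonneg_right hq hg₀.le
      _ = r * (g₀ * D) := by ring
      _ ≤ r * 1 := mul_le_mul_of_nonneg_left key hr
      _ = r := mul_one r
  have hBF : B ≤ F1 := by rw [hF1]; linarith
  have hCF : C ≤ F1 := by rw [hF1]; linarith
  have hcF : c ≤ F1 := by rw [hF1]; linarith
  have hNx : N + x ≤ F2 := by rw [hF2]; linarith
  have hFW0 : 0 ≤ F1 * W := mul_nonneg hF10 hW0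
  have c1 : g₀ ≤ 1 / 4 := by
    have := aux (q := 1) (r := 1 / 4) (by norm_num) (by rw [hD]; linarith)
    simpa using this
  have c2 : B * g₀ ≤ 1 / 4 := aux (by norm_num) (by rw [hD]; linarith)
  have c3 : 2 * B * g₀ * (N + 1 / (Ω - 1)) ≤ 1 / 2 := by
    have h1 : B * (N + x) ≤ F1 * W :=
      (mul_le_mul hBF (hNx.trans hF2W) (by linarith) hF10)
    have : 2 * B * (N + x) * g₀ ≤ 1 / 2 := by
      refine aux (by norm_num) ?_
      calc 2 * B * (N + x) = 2 * (B * (N + x)) := by ring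
        _ ≤ 2 * (F1 * W) := by linarith
        _ ≤ 1 / 2 * D := by rw [hD]; linarith
    rw [← hx]; linarith
  have c4 : 4 * C * g₀ ≤ 1 := aux zero_le_one (by rw [hD]; linarith)
  have c5 : 8 * C * g₀ * (N + 1 / (Ω - 1)) ≤ 1 := by
    have h1 : C * (N + x) ≤ F1 * W :=
      (mul_le_mul hCF (hNx.trans hF2W) (by linarith) hF10)
    have : 8 * C * (N + x) * g₀ ≤ 1 := by
      refine aux zero_le_one ?_
      calc 8 * C * (N + x) = 8 * (C * (N + x)) := by ring
        _ ≤ 8 * (F1 * W) := by linarith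
        _ = 1 * D := by rw [hD]; ring
    rw [← hx]; linarith
  have c6 : 2 * C * g₀ * (1 + 2 * C * ((1 + N) / c + N + 2 * Ω / (Ω - 1))) ≤ (lam - 1) / 2 := by
    have hSdef : (1 + N) / c + N + 2 * Ω / (Ω - 1) = S := rfl
    rw [hSdef]
    have hne : lam - 1 ≠ 0 := by linarith
    have hF4e : (lam - 1) * F4 = lam + 1 := by
      rw [hF4, mul_add, mul_one, mul_div_cancel₀ _ hne]; ring
    -- `2C F3 ≤ ((λ-1)/2) D`: `((λ-1)/2) D = 4 F1 F2 F3 (λ+1) ≥ 8 F1 F3 ≥ 2 C F3`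
    have h2 : (lam - 1) / 2 * D = 4 * F1 * F2 * F3 * (lam + 1) := by
      rw [hD, hW, ← hF4e]; ring
    have h3 : 2 * C * F3 ≤ (lam - 1) / 2 * D := by
      rw [h2]
      have hCF3 : C * F3 ≤ F1 * F3 := mul_le_mul_of_nonneg_right hCF hF30
      have h4 : F1 * F3 ≤ F1 * F2 * F3 := by
        have := le_mul_of_one_le_right (mul_nonneg hF10 hF30) hF2'
        calc F1 * F3 ≤ F1 * F3 * F2 := this
          _ = F1 * F2 * F3 := by ring
      have h5 : 0 ≤ F1 * F2 * F3 := by positivity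
      have hCF30 : 0 ≤ C * F3 := mul_nonneg hC hF30
      calc 2 * C * F3 = 2 * (C * F3) := by ring
        _ ≤ 8 * (C * F3) := by linarith
        _ ≤ 8 * (F1 * F2 * F3) := by linarith [hCF3.trans h4]
        _ = 4 * (F1 * F2 * F3) * 2 := by ring
        _ ≤ 4 * (F1 * F2 * F3) * (lam + 1) :=
            mul_le_mul_of_nonneg_left (by linarith) (by positivity)
        _ = 4 * F1 * F2 * F3 * (lam + 1) := by ring
    have : 2 * C * F3 * g₀ ≤ (lam - 1) / 2 := aux (by linarith) h3
    rw [hF3] at this; linarith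
  have c7 : c * g₀ ≤ 1 / 4 := aux (by norm_num) (by rw [hD]; linarith)
  have c8 : 2 * (N : ℝ) * (2 * B + c) * g₀ ≤ 1 / 2 := by
    refine aux (by norm_num) ?_
    have h1 : (N : ℝ) * (2 * B + c) ≤ W * (2 * F1) :=
      mul_le_mul ((le_add_of_nonneg_left (by linarith : (0:ℝ) ≤ 1 + x)).trans
        (by rw [hF2] at hF2W; linarith [hF2W])) (by linarith) (by linarith) hW0
    calc 2 * (N : ℝ) * (2 * B + c) = 2 * ((N : ℝ) * (2 * B + c)) := by ring
      _ ≤ 2 * (W * (2 * F1)) := by linarith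
      _ = 1 / 2 * D := by rw [hD]; ring
  -- assemble
  obtain ⟨s, hs, hs'⟩ := hA1.exc
  obtain ⟨s₂, hs₂, hs₂'⟩ := hA2.zeta_exc
  have hG : CutoffGbarHyp P.β Ω (jOmega P.β Ω) B c N g₀ :=
    ⟨hΩ, fun j => hA1.abs_le_mul_chi hΩ.le j, hc, ⟨s, Nat.le_floor hs, hs'⟩, hg₀, c1, c2, c3⟩
  refine ⟨⟨hG, hlam, hA2.lam_le, hC, ⟨s₂, Nat.le_floor hs₂, hs₂'⟩, hA2.eta_le, hA2.gamma_le,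
    hA2.theta_le, hA2.zeta_le, hA2.υgg_le, hA2.υgz_le, hA2.υgμ_le, hA2.υzz_le, hA2.υzμ_le, c4, c5, c6⟩,
    c7, c8⟩

/-- **[BBS-rg-flow, Proposition 1.2] (existence, uniqueness and the estimates (1.9))** =
**BBS 2015, Proposition 6.1.1**, with explicit constants depending only on the constants of
(A1)–(A2) and `Ω` ("with constants independent of `j_Ω` and `ḡ₀`"): assume (A1)–(A2) with constants
`(Ω, B, c, λ, C)`; then for every `g₀ ∈ (0, g₁)` the sequence `V̄ = (ḡ, z̄, μ̄) = P.flow g₀` is a global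
flow of `φ̄` with `ḡ₀ = g₀` and `(z̄_∞, μ̄_∞) = (0,0)`, it is the UNIQUE such flow, and
`0 < ḡ_j ≤ 2ḡ₀`, `χ_jḡ_jⁿ ≤ C_n(ḡ₀/(1+ḡ₀j))ⁿ` for real `n ≥ 1`, `|z̄_j| ≤ C'χ_jḡ_j`, `|μ̄_j| ≤ C'χ_jḡ_j`.
(The regularity clauses of Proposition 1.2 — `C¹` in `g₀`, continuity in an external parameter — are
Lemma 2.3 and the last part of Lemma 2.2, not treated here.)
[cite: BauerschmidtBrydgesSlade2015Flow, Proposition 1.2, (1.9)] [cite: BauerschmidtBrydgesSlade2015LogCorr, Proposition 6.1.1] -/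
theorem quadFlow_exists_unique {Ω B c lam C : ℝ} (hΩ : 1 < Ω) (hc : 0 < c) (hlam : 1 < lam) :
    ∃ g₁ C' : ℝ, ∃ Cn : ℝ → ℝ, 0 < g₁ ∧
      ∀ P : QuadFlowParams, HypA1 P.β Ω B c → HypA2 P Ω lam c C →
        ∀ g₀ ∈ Set.Ioo 0 g₁,
          IsQuadFlowBC P g₀ (P.flow g₀) ∧
          (∀ Vb : ℕ → V3, IsQuadFlowBC P g₀ Vb → Vb = P.flow g₀) ∧
          (∀ j, 0 < P.flow g₀ j 0 ∧ P.flow g₀ j 0 ≤ C' * g₀) ∧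
          (∀ n : ℝ, 1 ≤ n → ∀ j : ℕ,
            chi P.β Ω j * P.flow g₀ j 0 ^ n ≤ Cn n * (g₀ / (1 + g₀ * j)) ^ n) ∧
          (∀ j, |P.flow g₀ j 1| ≤ C' * chi P.β Ω j * P.flow g₀ j 0) ∧
          (∀ j, |P.flow g₀ j 2| ≤ C' * chi P.β Ω j * P.flow g₀ j 0) := by
  set N : ℕ := ⌊c⁻¹⌋₊ with hN
  set Cp : ℝ := max C 0 with hCp
  set S := sumSqConst Ω c N with hS
  -- the constants
  set Z : ℝ := 2 * Cp * S with hZ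
  set Kσ : ℝ := Cp * (3 + 3 * Z + Z ^ 2) / 2 with hKσ
  set C' : ℝ := max 2 (max Z (4 * Kσ / (lam - 1))) with hC'
  refine ⟨quadThreshold Ω B c C lam, C', fun n => 4 ^ n * max 1 (decayConst Ω n) * (max 1 c⁻¹) ^ n,
    quadThreshold_pos hΩ hc hlam, ?_⟩
  intro P hA1 hA2 g₀ hg₀
  obtain ⟨hg₀0, hg₀1⟩ := hg₀
  obtain ⟨hQ, hcg, hNg⟩ := cutoffQuadHyp_of_hypA hΩ hA1 hA2 hg₀0 hg₀1.le
  have hCeq : Cp = C := by rw [hCp, max_eq_left hQ.C_nonneg]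
  have hG := hQ.toCutoffGbarHyp
  have hSdef : (1 + (N : ℝ)) / c + N + 2 * Ω / (Ω - 1) = S := rfl
  refine ⟨hQ.isQuadFlowBC_flow, fun Vb hV => hQ.eq_flow_of_isQuadFlowBC hV, fun j => ?_,
    fun n hn j => ?_, fun j => ?_, fun j => ?_⟩
  · simp only [QuadFlowParams.flow_apply_zero]
    refine ⟨hG.gbar_pos j, (hG.gbar_le_two_mul_init j).trans ?_⟩
    exact mul_le_mul_of_nonneg_right (le_max_left _ _) hg₀0.le
  · simp only [QuadFlowParams.flow_apply_zero]
    exact hG.chi_mul_gbar_rpow_le hcg hNg hn j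
  · simp only [QuadFlowParams.flow_apply_one, QuadFlowParams.flow_apply_zero]
    have h1 := hQ.abs_zbar_le j
    rw [hSdef, ← hCeq] at h1
    refine h1.trans ?_
    rw [mul_assoc C']
    refine mul_le_mul_of_nonneg_right ?_ (mul_nonneg (hG.weight_pos j).le (hG.gbar_pos j).le)
    rw [hC']; exact le_trans (le_max_left _ _) (le_max_right _ _)
  · simp only [QuadFlowParams.flow_apply_two, QuadFlowParams.flow_apply_zero]
    have h1 := hQ.abs_mubar_le j
    rw [hSdef, ← hCeq] at h1
    refine h1.trans ?_
    rw [mul_assoc C']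
    refine mul_le_mul_of_nonneg_right ?_ (mul_nonneg (hG.weight_pos j).le (hG.gbar_pos j).le)
    rw [hC']; exact le_trans (le_max_right _ _) (le_max_right _ _)


end CTWSAW

end Literature.Barriers.CriticalPhenomena
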